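import Literature.MathematicalPhysics.KineticTheory.ReyBelletThomas2002Hormander
import Literature.MathematicalPhysics.KineticTheory.ReyBelletThomas2002Coercive
import Literature.MathematicalPhysics.KineticTheory.ConfinedForcedFlow
import HarnessLib

/-!
# Rey-Bellet–Thomas 2002: the effective equations (RBT-SDE) driven by a continuous reservoir-noise path — the drift is confined by the energy

Topic `Literature/MathematicalPhysics/KineticTheory` (trunk T-KINETIC). Provefact unit for the
named fact `ReyBelletThomas2002_thm21` (`ReyBelletThomas2002.lean`); first layer of the CONSTRUCTION of
the Markov semigroup of (RBT-SDE) (RBT §2: "The solution `x(t)` of Eq. (12) is a Markov process"):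
since the noise `(2γT)^{1/2} dω` enters (RBT-SDE) additively and only through the auxiliary
variables `r`, every continuous noise path `n : ℝ → RBPhaseSpace N` with values in the reservoir
directions (in the application `n(t) = (0, (√(2γT_L) ω_L(t), √(2γT_R) ω_R(t)))`) turns (RBT-SDE) into
the integral equation `z(t) = x + n(t) + ∫₀ᵗ X₀(z(s)) ds` with the drift `X₀ = rbDrift` of
`ReyBelletThomas2002Hormander.lean`, which is solved path by path by the model-free machinery of
`ConfinedForcedFlow.lean` once the drift is shown to be CONFINED by the energy `G`:

* `OscillatorChain.fderiv_rbEnergy_apply` — `DG(y)·v = DH(q,p)·(v_q, v_p) + r_L v_{r_L} + r_R v_{r_R}`;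
* `OscillatorChain.fderiv_rbEnergy_rbDrift` — **the energy balance along the driven dynamics**:
  `DG(y)·X₀(y + e) = -Λ (e_L ∑_{i=0} p_i + e_R ∑_{i=N-1} p_i) - γ(r_L² + r_R²) - γ(r_L e_L + r_R e_R)`
  for a reservoir perturbation `e = (0, (e_L, e_R))` (the Hamiltonian part conserves `G`, the
  reservoirs dissipate `γ r²`, the forcing injects; the deterministic skeleton of RBT's (28));
* `OscillatorChain.fderiv_rbEnergy_rbDrift_le` — hence `DG(y)·X₀(y + e) ≤ (2|Λ| + γ)‖e‖ (G(y) + c₀)`,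
  `c₀ = N/2 + 1 - N m_U - N² m_V` for potentials `U ≥ m_U`, `V ≥ m_V` (`m_U, m_V ≤ 0`, `γ ≥ 0`);
* `rbNoise` — the reservoir subspace `{0} × ℝ²` of `RBPhaseSpace N`; `OscillatorChain.rbRadius` — a
  monotone radius function for the (compact, by H1) sublevel sets of `G`;
  `OscillatorChain.rbConfinedDrift` — **`X₀` is a `ConfinedDrift`** for H1 potentials (growth
  exponents `≥ 1`) and `γ ≥ 0`, so `drivenFlow (P.rbDrift Λ N) x n` is the pathwise solution of
  (RBT-SDE): continuous, unique, a cocycle, continuous in `x`, measurable in the data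
  (`ConfinedForcedFlow.lean`).

## References

* L. Rey-Bellet, L. E. Thomas, Comm. Math. Phys. **225** (2002) 305–329 (arXiv:math-ph/0110024),
  §2 eq. (12)–(13), Lemma 3.5.
-/

noncomputable section

open Filter Set Metric Finset
open scoped ContDiff NNReal

namespace Literature.MathematicalPhysics.KineticTheory.HeatConduction

variable {N : ℕ}

/-! ### The reservoir (noise) subspace -/

/-- The subspace `{0} × ℝ²` of the extended phase space spanned by the reservoir directions
`∂_{r_L}, ∂_{r_R}` — where the additive noise of (RBT-SDE) acts. [folklore] -/
def rbNoise (N : ℕ) : Submodule ℝ (RBPhaseSpace N) :=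
  (⊥ : Submodule ℝ (PhaseSpace N)).prod ⊤

/-- Membership in the reservoir subspace: the phase-space component vanishes. [folklore] -/
theorem mem_rbNoise {e : RBPhaseSpace N} : e ∈ rbNoise N ↔ e.1 = 0 := by
  simp [rbNoise, Submodule.mem_prod]

/-- `(0, w)` lies in the reservoir subspace. [folklore] -/
theorem zero_prod_mem_rbNoise (w : ℝ × ℝ) : (((0 : PhaseSpace N), w) : RBPhaseSpace N) ∈ rbNoise N :=
  mem_rbNoise.2 rfl

namespace OscillatorChain

variable (P : OscillatorChain)

/-! ### The derivative of the energy -/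

/-- The reservoir part `(r_L² + r_R²)/2` of the energy has derivative `r_L v_{r_L} + r_R v_{r_R}`.
[folklore] -/
theorem hasFDerivAt_reservoirEnergy (y : RBPhaseSpace N) :
    HasFDerivAt (fun y : RBPhaseSpace N => (y.2.1 ^ 2 + y.2.2 ^ 2) / 2)
      (y.2.1 • ((ContinuousLinearMap.fst ℝ ℝ ℝ).comp (ContinuousLinearMap.snd ℝ (PhaseSpace N) (ℝ × ℝ))) +
        y.2.2 • ((ContinuousLinearMap.snd ℝ ℝ ℝ).comp (ContinuousLinearMap.snd ℝ (PhaseSpace N) (ℝ × ℝ)))) y := by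
  set L₁ := (ContinuousLinearMap.fst ℝ ℝ ℝ).comp (ContinuousLinearMap.snd ℝ (PhaseSpace N) (ℝ × ℝ))
  set L₂ := (ContinuousLinearMap.snd ℝ ℝ ℝ).comp (ContinuousLinearMap.snd ℝ (PhaseSpace N) (ℝ × ℝ))
  have h1 : HasFDerivAt (fun y : RBPhaseSpace N => y.2.1) L₁ y := L₁.hasFDerivAt
  have h2 : HasFDerivAt (fun y : RBPhaseSpace N => y.2.2) L₂ y := L₂.hasFDerivAt
  have h := ((h1.mul h1).add (h2.mul h2)).const_mul (1 / 2 : ℝ)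
  have hfun : (fun y : RBPhaseSpace N => (y.2.1 ^ 2 + y.2.2 ^ 2) / 2) =
      fun y : RBPhaseSpace N => 1 / 2 * (y.2.1 * y.2.1 + y.2.2 * y.2.2) := by
    funext z; ring
  rw [hfun]
  refine h.congr_fderiv ?_
  ext v <;> simp [L₁, L₂] <;> ring

/-- `G = H ∘ fst + (r_L² + r_R²)/2` is differentiable with
`DG(y)·v = DH(y.1)·v.1 + r_L v.2.1 + r_R v.2.2` (differentiable Hamiltonian). [folklore] -/
theorem hasFDerivAt_rbEnergy (hH : Differentiable ℝ (P.hamiltonian N)) (y : RBPhaseSpace N) :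
    HasFDerivAt (P.rbEnergy N)
      (y.2.1 • ((ContinuousLinearMap.fst ℝ ℝ ℝ).comp (ContinuousLinearMap.snd ℝ (PhaseSpace N) (ℝ × ℝ))) +
        y.2.2 • ((ContinuousLinearMap.snd ℝ ℝ ℝ).comp (ContinuousLinearMap.snd ℝ (PhaseSpace N) (ℝ × ℝ))) +
        (fderiv ℝ (P.hamiltonian N) y.1).comp (ContinuousLinearMap.fst ℝ (PhaseSpace N) (ℝ × ℝ))) y := by
  have hH' : HasFDerivAt (fun y : RBPhaseSpace N => P.hamiltonian N y.1)
      ((fderiv ℝ (P.hamiltonian N) y.1).comp (ContinuousLinearMap.fst ℝ (PhaseSpace N) (ℝ × ℝ))) y :=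
    (hH y.1).hasFDerivAt.comp y hasFDerivAt_fst
  exact (hasFDerivAt_reservoirEnergy y).add hH'

/-- `DG(y)·v = DH(y.1)·v.1 + r_L v.2.1 + r_R v.2.2`. [folklore] -/
theorem fderiv_rbEnergy_apply (hH : Differentiable ℝ (P.hamiltonian N)) (y v : RBPhaseSpace N) :
    fderiv ℝ (P.rbEnergy N) y v =
      fderiv ℝ (P.hamiltonian N) y.1 v.1 + y.2.1 * v.2.1 + y.2.2 * v.2.2 := by
  rw [(P.hasFDerivAt_rbEnergy hH y).fderiv]
  simp
  ring

/-- The energy is differentiable (differentiable Hamiltonian). [folklore] -/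
theorem differentiable_rbEnergy (hH : Differentiable ℝ (P.hamiltonian N)) :
    Differentiable ℝ (P.rbEnergy N) := fun y => (P.hasFDerivAt_rbEnergy hH y).differentiableAt

/-! ### The energy balance along the driven dynamics -/

/-- **The energy balance for (RBT-SDE) driven through the reservoirs**: for a differentiable
Hamiltonian, a point `y = ((q,p),(r_L,r_R))` and a reservoir perturbation `e = (0,(e_L,e_R))`,
`DG(y)·X₀(y + e) = -Λ (e_L ∑_{i=0} p_i + e_R ∑_{i=N-1} p_i) - γ(r_L² + r_R²) - γ(r_L e_L + r_R e_R)`: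
the Hamiltonian terms and the coupling terms `±Λ p_b r_b` cancel. [cite: ReyBelletThomas2002, Lemma 3.5] -/
theorem fderiv_rbEnergy_rbDrift (hH : Differentiable ℝ (P.hamiltonian N)) (Λ : ℝ)
    (y : RBPhaseSpace N) (e : ℝ × ℝ) :
    fderiv ℝ (P.rbEnergy N) y (P.rbDrift Λ N (y + ((0 : PhaseSpace N), e))) =
      -Λ * (e.1 * (∑ i : Fin N, if i.val = 0 then y.1.2 i else 0) +
          e.2 * (∑ i : Fin N, if i.val = N - 1 then y.1.2 i else 0)) -
        P.γ * (y.2.1 ^ 2 + y.2.2 ^ 2) - P.γ * (y.2.1 * e.1 + y.2.2 * e.2) := by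
  rw [P.fderiv_rbEnergy_apply hH, P.fderiv_hamiltonian_apply hH]
  have hz1 : (y + (((0 : PhaseSpace N), e) : RBPhaseSpace N)).1 = y.1 := by simp
  have hz21 : (y + (((0 : PhaseSpace N), e) : RBPhaseSpace N)).2.1 = y.2.1 + e.1 := by simp
  have hz22 : (y + (((0 : PhaseSpace N), e) : RBPhaseSpace N)).2.2 = y.2.2 + e.2 := by simp
  simp only [rbDrift, hz1, hz21, hz22]
  have key : ∀ i : Fin N,
      partialQ i (P.hamiltonian N) y.1 * y.1.2 i +
        y.1.2 i * (-partialQ i (P.hamiltonian N) y.1 -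
          Λ * ((if i.val = 0 then y.2.1 + e.1 else 0) + (if i.val = N - 1 then y.2.2 + e.2 else 0))) =
      -Λ * (y.2.1 + e.1) * (if i.val = 0 then y.1.2 i else 0) +
        -Λ * (y.2.2 + e.2) * (if i.val = N - 1 then y.1.2 i else 0) := by
    intro i; split_ifs <;> ring
  rw [Finset.sum_congr rfl fun i _ => key i, Finset.sum_add_distrib, ← Finset.mul_sum,
    ← Finset.mul_sum]
  ring

/-- The kinetic energy is controlled by the Hamiltonian when the potentials are bounded below:
`∑_i p_i²/2 + N m_U + N² m_V ≤ H(q,p)` (`m_V ≤ 0`). [folklore] -/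
theorem kinetic_le_hamiltonian {m_U m_V : ℝ} (hmV : m_V ≤ 0)
    (hU : ∀ q, m_U ≤ P.U q) (hV : ∀ q, m_V ≤ P.V q) (N : ℕ) (x : PhaseSpace N) :
    (∑ i, x.2 i ^ 2 / 2) + N * m_U + N ^ 2 * m_V ≤ P.hamiltonian N x := by
  unfold hamiltonian
  have h1 : (∑ i, x.2 i ^ 2 / 2) + N * m_U ≤ ∑ j : Fin N, (x.2 j ^ 2 / 2 + P.U (x.1 j)) := by
    rw [Finset.sum_add_distrib]
    have h2 : (N : ℝ) * m_U ≤ ∑ j : Fin N, P.U (x.1 j) := by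
      have := Finset.card_nsmul_le_sum (Finset.univ : Finset (Fin N)) (fun j => P.U (x.1 j)) m_U
        (fun j _ => hU (x.1 j))
      rwa [nsmul_eq_mul, Finset.card_univ, Fintype.card_fin] at this
    linarith
  have h4 : (N : ℝ) ^ 2 * m_V ≤
      ∑ i' : Fin N, ∑ j : Fin N, (if j.val = i'.val + 1 then P.V (x.1 j - x.1 i') else 0) := by
    have h5 : ∀ i' j : Fin N, m_V ≤ (if j.val = i'.val + 1 then P.V (x.1 j - x.1 i') else 0) := by
      intro i' j
      split_ifs
      · exact hV _
      · exact hmV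
    calc (N : ℝ) ^ 2 * m_V = ∑ _i' : Fin N, ∑ _j : Fin N, m_V := by
          simp [Finset.sum_const, Finset.card_univ, Fintype.card_fin]; ring
      _ ≤ _ := Finset.sum_le_sum fun i' _ => Finset.sum_le_sum fun j _ => h5 i' j
  linarith

/-- **The energy grows at most linearly along the driven dynamics**: for a differentiable
Hamiltonian with potentials bounded below (`U ≥ m_U`, `V ≥ m_V`, `m_V ≤ 0`), `γ ≥ 0`, any
coupling `Λ`, any point `y` and any reservoir perturbation `e = (0,(e_L,e_R))`:
`DG(y)·X₀(y + e) ≤ (2|Λ| + γ) ‖e‖ (G(y) + N/2 + 1 - N m_U - N² m_V)` — from the energy balance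
with `|p_b|, |r_b| ≤ ½ + ½(·)²`, `∑ p_i²/2 ≤ H - N m_U - N² m_V` and `-γ r² ≤ 0`. [cite: ReyBelletThomas2002, Lemma 3.5] -/
theorem fderiv_rbEnergy_rbDrift_le (hH : Differentiable ℝ (P.hamiltonian N)) (hγ : 0 ≤ P.γ)
    {m_U m_V : ℝ} (hmV : m_V ≤ 0) (hU : ∀ q, m_U ≤ P.U q) (hV : ∀ q, m_V ≤ P.V q)
    (Λ : ℝ) (y : RBPhaseSpace N) (e : ℝ × ℝ) :
    fderiv ℝ (P.rbEnergy N) y (P.rbDrift Λ N (y + ((0 : PhaseSpace N), e))) ≤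
      (2 * |Λ| + P.γ) * ‖e‖ *
        (P.rbEnergy N y + ((N : ℝ) / 2 + 1 - (N * m_U + N ^ 2 * m_V))) := by
  rw [P.fderiv_rbEnergy_rbDrift hH]
  set A : ℝ := ∑ i : Fin N, if i.val = 0 then y.1.2 i else 0 with hA
  set B : ℝ := ∑ i : Fin N, if i.val = N - 1 then y.1.2 i else 0 with hB
  set S : ℝ := ∑ i : Fin N, |y.1.2 i| with hS
  set K₀ : ℝ := N * m_U + N ^ 2 * m_V with hK₀
  set Hq : ℝ := P.hamiltonian N y.1 with hHq
  have hG : P.rbEnergy N y = (y.2.1 ^ 2 + y.2.2 ^ 2) / 2 + Hq := rfl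
  -- `|A|, |B| ≤ S ≤ N/2 + ∑ p²/2 ≤ N/2 + H - K₀`
  have hAS : |A| ≤ S := (Finset.abs_sum_le_sum_abs _ _).trans
    (Finset.sum_le_sum fun i _ => by split_ifs <;> simp)
  have hBS : |B| ≤ S := (Finset.abs_sum_le_sum_abs _ _).trans
    (Finset.sum_le_sum fun i _ => by split_ifs <;> simp)
  have hSle : S ≤ N / 2 + ∑ i : Fin N, y.1.2 i ^ 2 / 2 := by
    calc S ≤ ∑ i : Fin N, (1 / 2 + y.1.2 i ^ 2 / 2) :=
          Finset.sum_le_sum fun i _ => abs_le_half_add_sq_half (y.1.2 i)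
      _ = N / 2 + ∑ i : Fin N, y.1.2 i ^ 2 / 2 := by
          rw [Finset.sum_add_distrib, Finset.sum_const, Finset.card_univ, Fintype.card_fin,
            nsmul_eq_mul]
          ring
  have hkin : (∑ i : Fin N, y.1.2 i ^ 2 / 2) + K₀ ≤ Hq := by
    have := P.kinetic_le_hamiltonian hmV hU hV N y.1
    rw [hK₀]; linarith
  have hS' : S ≤ N / 2 + Hq - K₀ := by linarith
  -- the noise components
  have he1 : |e.1| ≤ ‖e‖ := by simpa [Real.norm_eq_abs] using norm_fst_le e
  have he2 : |e.2| ≤ ‖e‖ := by simpa [Real.norm_eq_abs] using norm_snd_le e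
  have he0 : 0 ≤ ‖e‖ := norm_nonneg e
  -- term 1: `-Λ (e₁ A + e₂ B) ≤ 2|Λ| ‖e‖ S`
  have h1 : -Λ * (e.1 * A + e.2 * B) ≤ 2 * |Λ| * ‖e‖ * S := by
    have hx : |e.1 * A + e.2 * B| ≤ ‖e‖ * S + ‖e‖ * S := by
      refine (abs_add_le _ _).trans (add_le_add ?_ ?_)
      · rw [abs_mul]; exact mul_le_mul he1 hAS (abs_nonneg _) he0
      · rw [abs_mul]; exact mul_le_mul he2 hBS (abs_nonneg _) he0
    have hle : -(Λ * (e.1 * A + e.2 * B)) ≤ |Λ| * |e.1 * A + e.2 * B| := by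
      rw [← abs_mul]; exact neg_le_abs _
    have h3 : |Λ| * |e.1 * A + e.2 * B| ≤ |Λ| * (‖e‖ * S + ‖e‖ * S) :=
      mul_le_mul_of_nonneg_left hx (abs_nonneg Λ)
    calc -Λ * (e.1 * A + e.2 * B) = -(Λ * (e.1 * A + e.2 * B)) := by ring
      _ ≤ |Λ| * (‖e‖ * S + ‖e‖ * S) := hle.trans h3
      _ = 2 * |Λ| * ‖e‖ * S := by ring
  -- term 3: `-γ (r_L e₁ + r_R e₂) ≤ γ ‖e‖ (1 + r²/2)`
  have h3 : -(P.γ * (y.2.1 * e.1 + y.2.2 * e.2)) ≤ P.γ * ‖e‖ * (1 + (y.2.1 ^ 2 + y.2.2 ^ 2) / 2) := by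
    have hr : |y.2.1 * e.1 + y.2.2 * e.2| ≤ ‖e‖ * (|y.2.1| + |y.2.2|) := by
      refine (abs_add_le _ _).trans ?_
      rw [abs_mul, abs_mul, mul_add]
      exact add_le_add (by nlinarith [abs_nonneg y.2.1]) (by nlinarith [abs_nonneg y.2.2])
    have hab : |y.2.1| + |y.2.2| ≤ 1 + (y.2.1 ^ 2 + y.2.2 ^ 2) / 2 := by
      have := abs_le_half_add_sq_half y.2.1
      have := abs_le_half_add_sq_half y.2.2
      linarith
    have h4 : ‖e‖ * (|y.2.1| + |y.2.2|) ≤ ‖e‖ * (1 + (y.2.1 ^ 2 + y.2.2 ^ 2) / 2) :=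
      mul_le_mul_of_nonneg_left hab he0
    have h5 := neg_le_abs (y.2.1 * e.1 + y.2.2 * e.2)
    nlinarith [mul_le_mul_of_nonneg_left (hr.trans h4) hγ]
  -- term 2: `-γ r² ≤ 0`
  have h2 : -(P.γ * (y.2.1 ^ 2 + y.2.2 ^ 2)) ≤ 0 := by
    have : 0 ≤ y.2.1 ^ 2 + y.2.2 ^ 2 := by positivity
    nlinarith
  -- assemble
  have hcoef1 : 0 ≤ 2 * |Λ| * ‖e‖ := by positivity
  have hcoef2 : 0 ≤ P.γ * ‖e‖ := by positivity
  have hp1 : 2 * |Λ| * ‖e‖ * S ≤ 2 * |Λ| * ‖e‖ * (N / 2 + Hq - K₀) := mul_le_mul_of_nonneg_left hS' hcoef1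
  have hr2 : 0 ≤ (y.2.1 ^ 2 + y.2.2 ^ 2) / 2 := by positivity
  have hHK : K₀ ≤ Hq := by
    have : 0 ≤ ∑ i : Fin N, y.1.2 i ^ 2 / 2 := Finset.sum_nonneg fun i _ => by positivity
    linarith
  have hq1 : 2 * |Λ| * ‖e‖ * (N / 2 + Hq - K₀) ≤
      2 * |Λ| * ‖e‖ * (P.rbEnergy N y + (N / 2 + 1 - K₀)) := by
    refine mul_le_mul_of_nonneg_left ?_ hcoef1
    rw [hG]; linarith
  have hq2 : P.γ * ‖e‖ * (1 + (y.2.1 ^ 2 + y.2.2 ^ 2) / 2) ≤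
      P.γ * ‖e‖ * (P.rbEnergy N y + (N / 2 + 1 - K₀)) := by
    refine mul_le_mul_of_nonneg_left ?_ hcoef2
    rw [hG]
    have hN : (0 : ℝ) ≤ N / 2 := by positivity
    linarith
  have htot : -Λ * (e.1 * A + e.2 * B) - P.γ * (y.2.1 ^ 2 + y.2.2 ^ 2) -
      P.γ * (y.2.1 * e.1 + y.2.2 * e.2) ≤
      2 * |Λ| * ‖e‖ * (P.rbEnergy N y + (N / 2 + 1 - K₀)) +
        P.γ * ‖e‖ * (P.rbEnergy N y + (N / 2 + 1 - K₀)) := by linarith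
  refine htot.trans (le_of_eq ?_)
  rw [hK₀]; ring

/-! ### A monotone radius for the sublevel sets of the energy -/

/-- A radius `ρ(B)` of a ball (centred at `0`) containing the sublevel set `{G ≤ B}`: the infimum of
the admissible nonnegative radii (meaningful when the sublevel sets are bounded, e.g. under H1).
[folklore] -/
def rbRadius (N : ℕ) (B : ℝ) : ℝ :=
  sInf {r : ℝ | 0 ≤ r ∧ ∀ y : RBPhaseSpace N, P.rbEnergy N y ≤ B → ‖y‖ ≤ r}

/-- If the sublevel sets of `G` are compact, admissible radii exist. [folklore] -/
theorem exists_admissible_radius (hcpt : ∀ E : ℝ, IsCompact {x : RBPhaseSpace N | P.rbEnergy N x ≤ E})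
    (B : ℝ) : ∃ r : ℝ, 0 ≤ r ∧ ∀ y : RBPhaseSpace N, P.rbEnergy N y ≤ B → ‖y‖ ≤ r := by
  obtain ⟨r, hr⟩ := (hcpt B).isBounded.subset_closedBall 0
  refine ⟨max r 0, le_max_right _ _, fun y hy => ?_⟩
  have := hr (show y ∈ {x : RBPhaseSpace N | P.rbEnergy N x ≤ B} from hy)
  rw [mem_closedBall, dist_zero_right] at this
  exact this.trans (le_max_left _ _)

/-- `G y ≤ B ⟹ ‖y‖ ≤ ρ(B)` (compact sublevel sets). [folklore] -/
theorem norm_le_rbRadius (hcpt : ∀ E : ℝ, IsCompact {x : RBPhaseSpace N | P.rbEnergy N x ≤ E})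
    {y : RBPhaseSpace N} {B : ℝ} (hy : P.rbEnergy N y ≤ B) : ‖y‖ ≤ P.rbRadius N B := by
  obtain ⟨r, hr0, hr⟩ := P.exists_admissible_radius hcpt B
  exact le_csInf ⟨r, hr0, hr⟩ fun r' hr' => hr'.2 y hy

/-- The radius is monotone in the level (compact sublevel sets). [folklore] -/
theorem rbRadius_mono (hcpt : ∀ E : ℝ, IsCompact {x : RBPhaseSpace N | P.rbEnergy N x ≤ E}) :
    Monotone (P.rbRadius N) := by
  intro B B' hBB'
  obtain ⟨r, hr0, hr⟩ := P.exists_admissible_radius hcpt B'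
  refine csInf_le_csInf ⟨0, fun r' hr' => hr'.1⟩ ⟨r, hr0, hr⟩ fun r' hr' => ?_
  exact ⟨hr'.1, fun y hy => hr'.2 y (hy.trans hBB')⟩

/-! ### The drift of (RBT-SDE) is confined by the energy -/

/-- **The drift `X₀` of (RBT-SDE) is a confined drift** for potentials `U, V` satisfying H1 (growth
exponents `≥ 1`) and `γ ≥ 0`: energy `V = G`, constant `c = N/2 + 1 - N m_U - N² m_V` with the lower
bounds `m_U, m_V ≤ 0` of the potentials (H1), rate `K(M) = (2|Λ| + γ) M`, radius `rbRadius`, noise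
subspace `rbNoise` (`{0} × ℝ²`). Consequently `drivenFlow (P.rbDrift Λ N)` is the pathwise solution of
(RBT-SDE) with all the properties of `ConfinedForcedFlow.lean`.
[cite: ReyBelletThomas2002, §2 eq. (12) and Lemma 3.5] -/
def rbConfinedDrift {k₁ k₂ : ℝ} (hU : RBGrowth P.U k₁) (hV : RBGrowth P.V k₂) (hk₁ : 1 ≤ k₁)
    (hk₂ : 1 ≤ k₂) (hγ : 0 ≤ P.γ) (Λ : ℝ) (N : ℕ) : ConfinedDrift (P.rbDrift Λ N) :=
  let m_U : ℝ := min (Classical.choose (hU.exists_forall_le hk₁)) 0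
  let m_V : ℝ := min (Classical.choose (hV.exists_forall_le hk₂)) 0
  have hmV : m_V ≤ 0 := min_le_right _ _
  have hUb : ∀ q, m_U ≤ P.U q := fun q =>
    (min_le_left _ _).trans (Classical.choose_spec (hU.exists_forall_le hk₁) q)
  have hVb : ∀ q, m_V ≤ P.V q := fun q =>
    (min_le_left _ _).trans (Classical.choose_spec (hV.exists_forall_le hk₂) q)
  have hH : Differentiable ℝ (P.hamiltonian N) :=
    (P.contDiff_hamiltonian hU.1 hV.1 N).differentiable (by simp)
  have hcpt : ∀ E : ℝ, IsCompact {x : RBPhaseSpace N | P.rbEnergy N x ≤ E} :=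
    P.isCompact_setOf_rbEnergy_le hU hV hk₁ hk₂ N
  { V := P.rbEnergy N
    c := (N : ℝ) / 2 + 1 - (N * m_U + N ^ 2 * m_V)
    K := fun M => (2 * |Λ| + P.γ) * M
    ρ := P.rbRadius N
    noise := rbNoise N
    contDiff_drift := (P.contDiff_rbDrift hU.1 hV.1 Λ N).of_le (by exact_mod_cast le_top)
    differentiable_energy := P.differentiable_rbEnergy hH
    energy_nonneg := fun y => by
      have hkin := P.kinetic_le_hamiltonian hmV hUb hVb N y.1
      have hG : P.rbEnergy N y = (y.2.1 ^ 2 + y.2.2 ^ 2) / 2 + P.hamiltonian N y.1 := rfl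
      have h0 : 0 ≤ ∑ i : Fin N, y.1.2 i ^ 2 / 2 := Finset.sum_nonneg fun i _ => by positivity
      have h1 : 0 ≤ (y.2.1 ^ 2 + y.2.2 ^ 2) / 2 := by positivity
      have hN : (0 : ℝ) ≤ N / 2 := by positivity
      linarith
    rate_nonneg := fun M hM => by positivity
    fderiv_energy_le := fun M y e he heM => by
      have he1 : e.1 = 0 := mem_rbNoise.1 he
      have he' : e = (((0 : PhaseSpace N), e.2) : RBPhaseSpace N) := by
        ext <;> simp [he1]
      rw [he']
      refine (P.fderiv_rbEnergy_rbDrift_le hH hγ hmV hUb hVb Λ y e.2).trans ?_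
      have hG0 : 0 ≤ P.rbEnergy N y + ((N : ℝ) / 2 + 1 - (N * m_U + N ^ 2 * m_V)) := by
        have hkin := P.kinetic_le_hamiltonian hmV hUb hVb N y.1
        have hG : P.rbEnergy N y = (y.2.1 ^ 2 + y.2.2 ^ 2) / 2 + P.hamiltonian N y.1 := rfl
        have h0 : 0 ≤ ∑ i : Fin N, y.1.2 i ^ 2 / 2 := Finset.sum_nonneg fun i _ => by positivity
        have h1 : 0 ≤ (y.2.1 ^ 2 + y.2.2 ^ 2) / 2 := by positivity
        have hN : (0 : ℝ) ≤ N / 2 := by positivity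
        linarith
      have he2 : ‖e.2‖ ≤ M := (norm_snd_le e).trans heM
      have hc : 0 ≤ 2 * |Λ| + P.γ := by positivity
      exact mul_le_mul_of_nonneg_right (mul_le_mul_of_nonneg_left he2 hc) hG0
    norm_le_radius := fun y B hy => P.norm_le_rbRadius hcpt hy
    radius_mono := P.rbRadius_mono hcpt }

end OscillatorChain

end Literature.MathematicalPhysics.KineticTheory.HeatConduction
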